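import Mathlib.Tactic.Linarith
import Summits.CriticalPhenomena.PercolationContinuityZ3.Theorems.PercNearOneGluingNoHeavyLowerTailSahiCTCNcSplitNested
import Summits.CriticalPhenomena.PercolationContinuityZ3.Theorems.PercNearOneGluingNoHeavyLowerTailSahiCTCPara2Moves
import HarnessLib

/-!
# `NoHeavyLowerTail` (crux stmt-CriticalPhenomena-4575), P3 lane: the MOVES of the level-split form `R_c` — how `R_c(K_X,K_Z)` changes when one
# face `F` is removed from `K_X`: private face (any size) or common face above level `c`: `R_c` RISES; common face of size `≤ c`: `R_c` FALLS

Support file (seat `prim-l12-p3`, gen 23; `--supports stmt-CriticalPhenomena-4575`).  Memo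
`run/shared/lean/prim/prim-l12/FROM-prim-l12-p3-g23-LEVEL-SPLIT.md` §1.3.  Companion of `…SahiCTCNcSplit` (`R_c = D_c·(Π·h_Y − K_X·K_Z) +
Π·t_X·t_Z`) and of `…SahiCTCNcSplitTMoves` (the moves of `T_c`).

For families `K_X, K_Z` and `F ∈ K_X` (all identities are polynomial identities; down-set hypotheses enter only the sign statements):
* `RcForm_erase_private_small` : `#F ≤ c`, `F ∉ K_Z` ⇒ `R_c(K_X∖F) = R_c(K_X) + D_c·r^F·K_Z`;
* `RcForm_erase_big`           : `#F > c` (private OR common) ⇒ `R_c(K_X∖F) = R_c(K_X) + r^F·(D_c·K_Z − Π·t_Z) = R_c(K_X) + r^F·(D_c·h_Z −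
  Θ_c·t_Z)` (`DdC_mul_sub_PiP_mul_facesGT`), and `D_c·h_Z − Θ_c·t_Z ∈ ℕ[r]` for a down-set `K_Z` (`…SahiCTCNcGen.coeff_lymClassC_sub_nonneg`,
  LYM across the classes `≤ c < ·`);
* `RcForm_erase_common_small`  : `#F ≤ c`, `F ∈ K_Z` ⇒ `R_c(K_X∖F) = R_c(K_X) − D_c·r^F·(Π − K_Z)`.
Hence (`coeff_RcForm_le_erase_private_small`, `coeff_RcForm_le_erase_big`, `coeff_RcForm_erase_common_small_le`): `R_c` is ANTITONE in
private faces of every size and in common faces above level `c`, and MONOTONE in common faces of size `≤ c`; so (LS_c) for `R_c` reduces to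
pairs saturated with private and big faces from which the common maximal faces of size `≤ c` have been removed.  No positivity of `R_c` in
general is claimed; nothing is asserted about the crux.
-/

namespace Summit.CriticalPhenomena.PercolationContinuityZ3.Theorems.SahiCTCForms

open Finset MvPolynomial SahiCTCGenFun

variable {α : Type*} [DecidableEq α] [Fintype α]

/-! ### Private faces -/

/-- **Private small move**: `#F ≤ c`, `F ∉ K_Z` ⇒ `R_c(K_X∖F, K_Z) = R_c(K_X, K_Z) + D_c·r^F·K_Z`. [this work] -/
theorem RcForm_erase_private_small {c : ℕ} {K KZ : Finset (Finset α)} {F : Finset α} (hFK : F ∈ K) (hF : #F ≤ c) (hFZ : F ∉ KZ) :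
    RcForm c (K.erase F) KZ = RcForm c K KZ + DdC c * monomial (ind F) 1 * gf KZ := by
  obtain ⟨h3, -⟩ := commonFamilies_erase_of_notMem' (c := c) (K := K) hFZ
  unfold RcForm
  rw [h3, facesGT_erase_small hF, gf_erase_add hFK]
  ring

/-- **Private or common BIG move**: `#F > c` ⇒ `R_c(K_X∖F, K_Z) = R_c(K_X, K_Z) + r^F·(D_c·K_Z − Π·t_Z)`. [this work] -/
theorem RcForm_erase_big {c : ℕ} {K KZ : Finset (Finset α)} {F : Finset α} (hFK : F ∈ K) (hF : c < #F) :
    RcForm c (K.erase F) KZ = RcForm c K KZ + monomial (ind F) 1 * (DdC c * gf KZ - PiP * gf (facesGT c KZ)) := by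
  obtain ⟨h1, h2⟩ := facesGT_erase_big hFK hF
  obtain ⟨h3, -⟩ := commonFamilies_erase_big (K := K) (KZ := KZ) hF
  have hgt : gf (facesGT c K) = gf (facesGT c (K.erase F)) + monomial (ind F) 1 := by
    rw [h1]; unfold gf; rw [sum_erase_add _ _ h2]
  unfold RcForm
  rw [h3, gf_erase_add hFK, hgt]
  ring

/-- The bracket of the big move is the class-LYM polynomial: `D_c·K_Z − Π·t_Z = D_c·h_Z − Θ_c·t_Z`. [this work] -/
theorem DdC_mul_sub_PiP_mul_facesGT (c : ℕ) (KZ : Finset (Finset α)) :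
    (DdC c * gf KZ - PiP * gf (facesGT c KZ) : MvPolynomial α ℤ) = DdC c * gf (facesLE c KZ) - ThC c * gf (facesGT c KZ) := by
  rw [gf_eq_facesLE_add_facesGT c KZ, PiP_eq_ThC_add_DdC_gen (α := α) c]; ring

/-- Hence for a down-set `K_Z`: `R_c(K_X, K_Z) ≤ R_c(K_X∖F, K_Z)` coefficientwise when `F ∈ K_X` has size `> c` (private OR common). [this work] -/
theorem coeff_RcForm_le_erase_big {c : ℕ} {K KZ : Finset (Finset α)} (hKZ : IsLowerSet (KZ : Set (Finset α))) {F : Finset α}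
    (hFK : F ∈ K) (hF : c < #F) (n : α →₀ ℕ) : (RcForm c K KZ).coeff n ≤ (RcForm c (K.erase F) KZ).coeff n := by
  rw [RcForm_erase_big hFK hF, DdC_mul_sub_PiP_mul_facesGT, coeff_add]
  have := coeff_monomial_mul_nonneg F (coeff_lymClassC_sub_nonneg c hKZ) n
  linarith

/-- And `R_c(K_X, K_Z) ≤ R_c(K_X∖F, K_Z)` coefficientwise for a private small face `F` (`K_Z` any family). [this work] -/
theorem coeff_RcForm_le_erase_private_small {c : ℕ} {K KZ : Finset (Finset α)} {F : Finset α} (hFK : F ∈ K) (hF : #F ≤ c)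
    (hFZ : F ∉ KZ) (n : α →₀ ℕ) : (RcForm c K KZ).coeff n ≤ (RcForm c (K.erase F) KZ).coeff n := by
  obtain ⟨-, -, -, hDd⟩ := coeff_PiP_ee_nonneg (α := α) c
  rw [RcForm_erase_private_small hFK hF hFZ, mul_assoc, coeff_add]
  have := coeff_mul_nonneg hDd (coeff_monomial_mul_nonneg F (coeff_gf_nonneg KZ)) n
  linarith

/-! ### Common small faces -/

/-- Removing a common face of size `≤ c` from `K_X`: `h_Y` loses `F`. [this work] -/
theorem commonLE_erase_common_small {c : ℕ} {K KZ : Finset (Finset α)} {F : Finset α} (hFK : F ∈ K) (hF : #F ≤ c) (hFZ : F ∈ KZ) :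
    commonLE c (K.erase F) KZ = (commonLE c K KZ).erase F ∧ F ∈ commonLE c K KZ := by
  refine ⟨?_, mem_filter.2 ⟨mem_powerset.2 (subset_univ _), hF, hFK, hFZ⟩⟩
  ext T; simp only [commonLE, mem_filter, mem_erase, ne_eq]; tauto

/-- **Common small move**: `#F ≤ c`, `F ∈ K_Z` ⇒ `R_c(K_X∖F, K_Z) = R_c(K_X, K_Z) − D_c·r^F·(Π − K_Z)`. [this work] -/
theorem RcForm_erase_common_small {c : ℕ} {K KZ : Finset (Finset α)} {F : Finset α} (hFK : F ∈ K) (hF : #F ≤ c) (hFZ : F ∈ KZ) :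
    RcForm c (K.erase F) KZ = RcForm c K KZ - DdC c * monomial (ind F) 1 * (PiP - gf KZ) := by
  obtain ⟨h3, h3'⟩ := commonLE_erase_common_small (c := c) hFK hF hFZ
  have hgy : gf (commonLE c K KZ) = gf (commonLE c (K.erase F) KZ) + monomial (ind F) 1 := by
    rw [h3]; unfold gf; rw [sum_erase_add _ _ h3']
  unfold RcForm
  rw [facesGT_erase_small hF, gf_erase_add hFK, hgy]
  ring

/-- `Π − GF(K)` has nonnegative coefficients. [this work] -/
theorem coeff_PiP_sub_gf_nonneg (K : Finset (Finset α)) (n : α →₀ ℕ) : 0 ≤ (PiP - gf K : MvPolynomial α ℤ).coeff n := by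
  have h : (PiP : MvPolynomial α ℤ) = gf K + gf (univ.powerset \ K) := by
    unfold PiP
    rw [← gf_union (disjoint_sdiff)]
    congr 1
    exact (union_sdiff_of_subset fun S _ => mem_powerset.2 (subset_univ S)).symm
  rw [h, add_sub_cancel_left]
  exact coeff_gf_nonneg _ n

/-- Hence `R_c(K_X∖F, K_Z) ≤ R_c(K_X, K_Z)` coefficientwise for a common face `F` of size `≤ c`: to prove `R_c(K_X,K_Z) ∈ ℕ[r]` it suffices to
prove it after deleting such faces from `K_X`. [this work] -/
theorem coeff_RcForm_erase_common_small_le {c : ℕ} {K KZ : Finset (Finset α)} {F : Finset α} (hFK : F ∈ K) (hF : #F ≤ c) (hFZ : F ∈ KZ)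
    (n : α →₀ ℕ) : (RcForm c (K.erase F) KZ).coeff n ≤ (RcForm c K KZ).coeff n := by
  obtain ⟨-, -, -, hDd⟩ := coeff_PiP_ee_nonneg (α := α) c
  rw [RcForm_erase_common_small hFK hF hFZ, mul_assoc, coeff_sub]
  have := coeff_mul_nonneg hDd (coeff_monomial_mul_nonneg F (coeff_PiP_sub_gf_nonneg KZ)) n
  linarith

/-- The inductive form: if `R_c(K_X∖F, K_Z) ∈ ℕ[r]` for a common face `F ∈ K_X` of size `≤ c`, then `R_c(K_X, K_Z) ∈ ℕ[r]`. [this work] -/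
theorem coeff_RcForm_nonneg_of_erase_common_small {c : ℕ} {K KZ : Finset (Finset α)} {F : Finset α} (hFK : F ∈ K) (hF : #F ≤ c)
    (hFZ : F ∈ KZ) (h : ∀ n, 0 ≤ (RcForm c (K.erase F) KZ).coeff n) : ∀ n, 0 ≤ (RcForm c K KZ).coeff n :=
  fun n => (h n).trans (coeff_RcForm_erase_common_small_le hFK hF hFZ n)

end Summit.CriticalPhenomena.PercolationContinuityZ3.Theorems.SahiCTCForms
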